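import Summits.ValiantsHypothesis.ValiantsHypothesis.Theorems.KPlusLogSqLawOctaveWitness
import Summits.ValiantsHypothesis.ValiantsHypothesis.Theorems.KPlusLogSqLawOctaveNewtonPolygon
import Summits.ValiantsHypothesis.ValiantsHypothesis.Theorems.KPlusLogSqLawOctaveRootNearBreakpoint
import Summits.ValiantsHypothesis.ValiantsHypothesis.Theorems.KPlusLogSqLawOctaveTemperedGlue
import Summits.ValiantsHypothesis.ValiantsHypothesis.Theorems.KPlusLogSqLawTropicalBSignsFree

/-!
# Route «KPlusLogSqLaw», octave door — line «newton-cells»: Newton CELLS of the true archimedean Newton polygon, the octave–cell lemma,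
# the height rung, and the kernel `NewtonCellLifting → OctaveWeakLifting` (all sorry-free)

HONEST FRAMING.  Helper file `--supports stmt-ValiantsHypothesis-19561` (crux `WeakLifting`, OPEN) for line «newton-cells» of ideator val-idea-1 (g4)
(`Cruxes/WeakLifting/Lines/newton_cells.lean` v2).  `NewtonCellLifting` (K1) and `NewtonCellLaw` (K1♯) are CANDIDATE LAWS recorded as `Prop`s, never
asserted; `OctaveWeakLifting` (stmt-24457), `WeakLifting`, `TropicalB`, Conjecture B stay OPEN; VP ≠ VNP is not moved.

* `newtonCells f := {⌊b⌋ : b ∈ newtonBreaks f}` — unit θ-cells met by a TRUE Newton breakpoint (representation-free; quotients flat vertex clusters).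
* R1 `octaveCount_le_newtonCells : Ω(f) ≤ (2(⌊log₂ t⌋+2)+2) · #newtonCells f` (from `root_near_newtonBreaks` + `cellCount_proof`);
  `octaveCount_pencilDet_le_newtonCells : Ω(det F) ≤ (2M+6) · V₁`, `M = m(⌊log₂ mK⌋+1)`.
* R2 `newtonCellLifting_of_newtonBreakLifting` (oc1's `NewtonBreakLifting` ⇒ K1), `newtonCellLifting_of_newtonCellLaw`, `budget_arith`.
* KERNEL `OctaveWeakLifting_of : NewtonCellLifting → OctaveWeakLifting` (signed row ⇒ `TropRowD m K (2n)` by `tropRowD_of_tropRootLawAt`, `C ↦ C+8`);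
  `valiant_of_tropicalB_of_newtonCellLifting : TropicalB → NewtonCellLifting → VP ≠ VNP`; `octaveKLaw_of_newtonCellLaw : NewtonCellLaw → OctaveKLaw`,
  `valiant_of_newtonCellLaw : NewtonCellLaw → VP ≠ VNP` (no tropical hypothesis).
* R3 (the height rung `#newtonCells f ≤ 2⌊√(2h)⌋+2`) is the companion file `KPlusLogSqLawOctaveNewtonCellsHeight.lean`.

References: G. Malajovich, J. Zubelli, "On the geometry of Graeffe iteration", J. Complexity 17 (2001) (archimedean Newton polygon / root moduli,
background only); A. Ostrowski, "Recherches sur la méthode de Graeffe…", Acta Math. 72 (1940) (roots near Newton polygon slopes, background only).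
Everything below is elementary and self-contained. [folklore]
-/

set_option linter.dupNamespace false
set_option autoImplicit false

namespace Summit.ValiantsHypothesis.ValiantsHypothesis.Theorems.KPlusLogSqLaw.Octave

open Polynomial Finset
open scoped BigOperators
open Summit.ValiantsHypothesis.ValiantsHypothesis.Theorems.KPlusLogSqLaw (TropRowD tropRowD_of_tropRootLawAt)
open Summit.ValiantsHypothesis.ValiantsHypothesis.Theorems.LacunarySymmetroidMatrixDescartes.TropicalCensus (TropRootLawAt)
open Summit.ValiantsHypothesis.ValiantsHypothesis.Theses.KPlusLogSqLaw (TropicalB)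

/-! ### The controlling quantity -/

/-- **Newton cells**: the unit `θ`-cells `[c, c+1)` (`c ∈ ℤ`) that contain a breakpoint of the TRUE archimedean Newton polygon of `p`.
[definition of the seat] -/
noncomputable def newtonCells (p : ℝ[X]) : Finset ℤ := (newtonBreaks p).image (fun b => ⌊b⌋)

/-- `V₁ ≤ V`: cells never outnumber breakpoints. [folklore] -/
theorem card_newtonCells_le (p : ℝ[X]) : (newtonCells p).card ≤ (newtonBreaks p).card := card_image_le

/-- every nonzero real root is within `⌊log₂ t⌋ + 2` of the CENTRE of a Newton cell (`t` = number of terms). [folklore] -/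
theorem root_near_newtonCells (p : ℝ[X]) (x : ℝ) (hx0 : x ≠ 0) (hp : p ≠ 0) (hroot : p.IsRoot x) :
    ∃ b ∈ (newtonCells p).image (fun c : ℤ => (c : ℝ) + 1 / 2),
      |Real.logb 2 |x| - b| ≤ ((Nat.log 2 p.support.card + 2 : ℕ) : ℝ) := by
  obtain ⟨b, hb, hdist⟩ := root_near_newtonBreaks p x hx0 hp hroot
  refine ⟨((⌊b⌋ : ℤ) : ℝ) + 1 / 2, mem_image.2 ⟨⌊b⌋, mem_image.2 ⟨b, hb, rfl⟩, rfl⟩, ?_⟩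
  have h1 : ((⌊b⌋ : ℤ) : ℝ) ≤ b := Int.floor_le b
  have h2 : b < ((⌊b⌋ : ℤ) : ℝ) + 1 := Int.lt_floor_add_one b
  have h3 : |b - (((⌊b⌋ : ℤ) : ℝ) + 1 / 2)| ≤ 1 / 2 := by rw [abs_le]; constructor <;> linarith
  calc |Real.logb 2 |x| - (((⌊b⌋ : ℤ) : ℝ) + 1 / 2)|
      ≤ |Real.logb 2 |x| - b| + |b - (((⌊b⌋ : ℤ) : ℝ) + 1 / 2)| := abs_sub_le _ _ _
    _ ≤ ((Nat.log 2 p.support.card + 1 : ℕ) : ℝ) + 1 / 2 := add_le_add hdist h3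
    _ ≤ ((Nat.log 2 p.support.card + 2 : ℕ) : ℝ) := by push_cast; linarith

/-- **R1, the octave–cell lemma** (design-free, depth-free, representation-free): a real polynomial with `t` terms has its nonzero real
roots in at most `(2(⌊log₂ t⌋ + 2) + 2) · V₁` dyadic octaves. [folklore] -/
theorem octaveCount_le_newtonCells (p : ℝ[X]) :
    octaveCount p ≤ (2 * (Nat.log 2 p.support.card + 2) + 2) * (newtonCells p).card :=
  (cellCount_proof p ((newtonCells p).image (fun c : ℤ => (c : ℝ) + 1 / 2)) (Nat.log 2 p.support.card + 2)
      (fun x hx hp hr => root_near_newtonCells p x hx hp hr)).trans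
    (Nat.mul_le_mul_left _ card_image_le)

variable {m K : ℕ}

/-- **R1 for pencils**: `Ω(det F) ≤ (2(M+2)+2) · V₁(det F)`, `M = m(⌊log₂(mK)⌋+1)` (a format polynomial, NOT a coefficient size). [folklore] -/
theorem octaveCount_pencilDet_le_newtonCells (d : Fin K → ℕ) (S : Fin K → Matrix (Fin m) (Fin m) ℝ) :
    octaveCount (pencilDet d S) ≤ (2 * (m * (Nat.log 2 (m * K) + 1) + 2) + 2) * (newtonCells (pencilDet d S)).card := by
  refine (octaveCount_le_newtonCells _).trans (Nat.mul_le_mul_right _ ?_)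
  have h : Nat.log 2 (pencilDet d S).support.card ≤ m * (Nat.log 2 (m * K) + 1) :=
    calc Nat.log 2 (pencilDet d S).support.card ≤ Nat.log 2 (2 ^ (m * (Nat.log 2 (m * K) + 1))) :=
          Nat.log_mono_right (card_support_pencilDet_le d S)
      _ = m * (Nat.log 2 (m * K) + 1) := Nat.log_pow one_lt_two _
  omega

/-! ### The candidate laws (Props, NOT asserted) -/

/-- **K1 `NewtonCellLifting`** (relative, door-shaped; candidate law, NOT a theorem): the unsigned tropical row bounds the number of
unit cells met by the TRUE Newton polygon's breakpoints, for every real symmetric pencil of the format, with slack `2^{C(K+⌊log₂m⌋²)}`.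
Why it might fail: MASKED POCKETS — dead / deep classes hide live class-tops, so true breakpoints can sit far from every design
breakpoint; a format family whose determinants have super-budget many such FAR cells (not merely far vertices) kills it. -/
def NewtonCellLifting : Prop :=
  ∃ C : ℕ, ∀ (m K n : ℕ), TropRowD m K n →
    ∀ (d : Fin K → ℕ) (S : Fin K → Matrix (Fin m) (Fin m) ℝ), (∀ l, (S l).IsSymm) →
      (newtonCells (pencilDet d S)).card ≤ 2 ^ (C * (K + Nat.log 2 m ^ 2)) * (n + 1)

/-- **K1♯ `NewtonCellLaw`** (absolute, row-free; candidate law, NOT a theorem): the TRUE Newton polygon of the determinant of a real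
symmetric `(m,K)` pencil meets at most `2^{C(K+⌊log₂m⌋²)}` unit cells.  At least as strong as the octave form of Conjecture B; given
`TropicalB` it is K1 up to the constant. -/
def NewtonCellLaw : Prop :=
  ∃ C : ℕ, ∀ (m K : ℕ) (d : Fin K → ℕ) (S : Fin K → Matrix (Fin m) (Fin m) ℝ), (∀ l, (S l).IsSymm) →
    (newtonCells (pencilDet d S)).card ≤ 2 ^ (C * (K + Nat.log 2 m ^ 2))

/-! ### R2: the dictionary (kernel-checked) -/

/-- oc1's raw-vertex candidate implies the cell law (cells never outnumber breakpoints). [folklore] -/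
theorem newtonCellLifting_of_newtonBreakLifting (h : NewtonBreakLifting) : NewtonCellLifting := by
  obtain ⟨C, hC⟩ := h
  exact ⟨C, fun m K n hT d S _ => (card_newtonCells_le _).trans (hC m K n hT d S)⟩

/-- the absolute form implies the relative form. [folklore] -/
theorem newtonCellLifting_of_newtonCellLaw (h : NewtonCellLaw) : NewtonCellLifting := by
  obtain ⟨C, hC⟩ := h
  refine ⟨C, fun m K n _ d S hS => (hC m K d S hS).trans ?_⟩
  exact Nat.le_mul_of_pos_right _ (Nat.succ_pos n)

/-- the format factor `2(m(⌊log₂ mK⌋+1)+2)+2`, doubled, is inside `2^{8(K+⌊log₂m⌋²)}` once `K ≥ 1`. [folklore] -/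
theorem factor_le_pow (m K : ℕ) (hK : 1 ≤ K) :
    2 * (2 * (m * (Nat.log 2 (m * K) + 1) + 2) + 2) ≤ 2 ^ (8 * (K + Nat.log 2 m ^ 2)) := by
  set L := Nat.log 2 m with hL
  have hm : m < 2 ^ (L + 1) := Nat.lt_pow_succ_log_self one_lt_two m
  have hlog : Nat.log 2 (m * K) ≤ L + K := by
    -- `⌊log₂ (mK)⌋ ≤ ⌊log₂ m⌋ + K` (cf. the landed `tdrPerNotQP_log_two_mul_le`, not imported to keep this file's cone small)
    rcases Nat.eq_zero_or_pos (m * K) with h0 | h0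
    · rw [h0, Nat.log_zero_right]; exact Nat.zero_le _
    · have hK2 : K < 2 ^ K := Nat.lt_two_pow_self
      have hmK : m * K < 2 ^ (L + K + 1) := by
        calc m * K < 2 ^ (L + 1) * 2 ^ K := Nat.mul_lt_mul'' hm hK2
          _ = 2 ^ (L + K + 1) := by rw [← pow_add]; ring_nf
      have := (Nat.log_lt_iff_lt_pow one_lt_two h0.ne').2 hmK
      omega
  have h1 : L + K + 1 ≤ 2 ^ (L + K) := Nat.lt_two_pow_self
  have h2 : m * (Nat.log 2 (m * K) + 1) ≤ 2 ^ (L + 1) * 2 ^ (L + K) :=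
    Nat.mul_le_mul hm.le ((Nat.add_le_add_right hlog 1).trans h1)
  have h3 : 2 * (2 * (m * (Nat.log 2 (m * K) + 1) + 2) + 2) ≤ 4 * (2 ^ (L + 1) * 2 ^ (L + K)) + 12 := by omega
  have h4 : 4 * (2 ^ (L + 1) * 2 ^ (L + K)) + 12 ≤ 2 ^ (2 * L + K + 4) := by
    have e1 : 4 * (2 ^ (L + 1) * 2 ^ (L + K)) = 2 ^ (2 * L + K + 3) := by
      rw [show (4 : ℕ) = 2 ^ 2 by norm_num, ← pow_add, ← pow_add]; ring_nf
    have e2 : 12 ≤ 2 ^ (2 * L + K + 3) := by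
      calc (12 : ℕ) ≤ 2 ^ 4 := by norm_num
        _ ≤ 2 ^ (2 * L + K + 3) := Nat.pow_le_pow_right (by norm_num) (by omega)
    calc 4 * (2 ^ (L + 1) * 2 ^ (L + K)) + 12 ≤ 2 ^ (2 * L + K + 3) + 2 ^ (2 * L + K + 3) := by rw [e1]; exact Nat.add_le_add_left e2 _
      _ = 2 ^ (2 * L + K + 4) := by rw [← two_mul, ← pow_succ']
  have h5 : 2 * L + K + 4 ≤ 8 * (K + L ^ 2) := by
    rcases Nat.eq_zero_or_pos L with hL0 | hL0
    · rw [hL0]; omega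
    · nlinarith
  exact h3.trans (h4.trans (Nat.pow_le_pow_right (by norm_num) h5))

/-- the budget bookkeeping: `F · (2^{C(K+L²)} · (2n+1)) ≤ 2^{(C+8)(K+L²)} · (n+1)` for the format factor `F`. [folklore] -/
theorem budget_arith (C m K n : ℕ) (hK : 1 ≤ K) :
    (2 * (m * (Nat.log 2 (m * K) + 1) + 2) + 2) * (2 ^ (C * (K + Nat.log 2 m ^ 2)) * (2 * n + 1)) ≤
      2 ^ ((C + 8) * (K + Nat.log 2 m ^ 2)) * (n + 1) := by
  set L := Nat.log 2 m with hL
  set F := 2 * (m * (Nat.log 2 (m * K) + 1) + 2) + 2 with hF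
  have hfac : 2 * F ≤ 2 ^ (8 * (K + L ^ 2)) := factor_le_pow m K hK
  calc F * (2 ^ (C * (K + L ^ 2)) * (2 * n + 1)) ≤ F * (2 ^ (C * (K + L ^ 2)) * (2 * (n + 1))) := by gcongr; omega
    _ = (2 * F) * 2 ^ (C * (K + L ^ 2)) * (n + 1) := by ring
    _ ≤ 2 ^ (8 * (K + L ^ 2)) * 2 ^ (C * (K + L ^ 2)) * (n + 1) := by gcongr
    _ = 2 ^ ((C + 8) * (K + L ^ 2)) * (n + 1) := by rw [← pow_add]; ring_nf

/-! ### K1 ⇒ Ω-W (the door, stmt-ValiantsHypothesis-24457, BY NAME) -/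

/-- **THE COMPOSITION (kernel-checked): `NewtonCellLifting → OctaveWeakLifting`** (the landed `Octave.OctaveWeakLifting`, δ-equal
to the route item).  Signed row ⇒ unsigned row `2n` (`tropRowD_of_tropRootLawAt`), K1 at `(m, K, 2n)`, R1, budget `C ↦ C + 8`;
`K = 0` pencils have no root octaves. [this line] -/
theorem OctaveWeakLifting_of (h : NewtonCellLifting) : OctaveWeakLifting := by
  obtain ⟨C, hC⟩ := h
  refine ⟨C + 8, fun m K n hT d S hS => ?_⟩
  show octaveCount (pencilDet d S) ≤ _
  rcases Nat.eq_zero_or_pos K with hK0 | hK0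
  · subst hK0
    rw [octaveCount_pencilDet_zero_letters]
    exact Nat.zero_le _
  · have hT' : TropRowD m K (2 * n) := tropRowD_of_tropRootLawAt hT
    have hV := hC m K (2 * n) hT' d S hS
    calc octaveCount (pencilDet d S)
        ≤ (2 * (m * (Nat.log 2 (m * K) + 1) + 2) + 2) * (newtonCells (pencilDet d S)).card :=
          octaveCount_pencilDet_le_newtonCells d S
      _ ≤ (2 * (m * (Nat.log 2 (m * K) + 1) + 2) + 2) * (2 ^ (C * (K + Nat.log 2 m ^ 2)) * (2 * n + 1)) :=
          Nat.mul_le_mul_left _ hV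
      _ ≤ 2 ^ ((C + 8) * (K + Nat.log 2 m ^ 2)) * (n + 1) := budget_arith C m K n hK0

/-- **VP ≠ VNP ⟸ TropicalB + K1 + (proved) Ω-Θ, SORRY-FREE composition** (`valiant_of_octave`, `octaveThetaWitness_proof`). [this line] -/
theorem valiant_of_tropicalB_of_newtonCellLifting (hT : TropicalB) (hK1 : NewtonCellLifting) : _root_.ValiantsHypothesis :=
  valiant_of_octave hT (OctaveWeakLifting_of hK1) octaveThetaWitness_proof

/-! ### K1♯ ⇒ the octave K-law ⇒ VP ≠ VNP, with NO tropical hypothesis -/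

/-- **`NewtonCellLaw` ⇒ the octave K-law `OctaveKLaw`**, constant `C ↦ C + 8`. [this line] -/
theorem octaveKLaw_of_newtonCellLaw (h : NewtonCellLaw) : OctaveKLaw := by
  obtain ⟨C, hC⟩ := h
  refine ⟨C + 8, fun m K d S hS => ?_⟩
  show octaveCount (pencilDet d S) ≤ _
  rcases Nat.eq_zero_or_pos K with hK0 | hK0
  · subst hK0
    rw [octaveCount_pencilDet_zero_letters]
    exact Nat.zero_le _
  · have hV := hC m K d S hS
    have hb := budget_arith C m K 0 hK0
    simp only [Nat.mul_zero, zero_add, Nat.mul_one] at hb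
    calc octaveCount (pencilDet d S)
        ≤ (2 * (m * (Nat.log 2 (m * K) + 1) + 2) + 2) * (newtonCells (pencilDet d S)).card :=
          octaveCount_pencilDet_le_newtonCells d S
      _ ≤ (2 * (m * (Nat.log 2 (m * K) + 1) + 2) + 2) * 2 ^ (C * (K + Nat.log 2 m ^ 2)) := Nat.mul_le_mul_left _ hV
      _ ≤ 2 ^ ((C + 8) * (K + Nat.log 2 m ^ 2)) := hb

/-- **VP ≠ VNP ⟸ K1♯ ALONE, SORRY-FREE composition** — no `TropicalB` (`valiant_of_octaveKLaw`, proved Ω-Θ inside). [this line] -/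
theorem valiant_of_newtonCellLaw (h : NewtonCellLaw) : _root_.ValiantsHypothesis :=
  valiant_of_octaveKLaw (octaveKLaw_of_newtonCellLaw h)

end Summit.ValiantsHypothesis.ValiantsHypothesis.Theorems.KPlusLogSqLaw.Octave
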